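import Summits.QuantumFields.BalabanUV.T4Continuum.Spine.NE1p.DressedRegenerationOnCores
import Summits.QuantumFields.BalabanUV.T4Continuum.Spine.NE1p.DressedSourceAnalyticWitness

/-!
# T⁴ programme, spine estimate NE1′ (node O3b/H2) — WITNESS «THE REGENERATION CONSTANT IS CHARGED»: S52's (B1a)-discharged
# (w5) END `regenPart_locE_le_of_coresAt_pencil_mass` APPLIED ONCE BY NAME on W35's letter-budget activity `actM` read along the
# STRENGTH pencil `0 + s • liveTable` of radius `1 < ϱ ≤ 2`; the bounded difference `E[actM 1](X₀) − E[actM 0](X₀)` is NOT zero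
# (W35 `coresMuEnd_live` at `t = 1`) — closed form `‖…‖ ≤ K₀(64,8)∕(ϱ − 1)`, best at `ϱ = 2`: `K₀(64,8)`

Cell `pub-balaban`, sub-cell `t4`, BINDER-OWNERS row NE1′; NE1′ formalisation crew, unit `b2b-balaban-t4-ne1p-formalise-leaf-03`
(LEAF PROVER 03, generation 14); crew row W68 ∕ DAG N29zzzv of `t4/formal/NE1p/LEAVES.md` (INTENT + STAGED journal l.22060, BOOKED typer R-T138 l.22332; own-lineage follower of S52 ∕ DAG N29zzzq
`DressedRegenerationOnCores` and W51 `DressedSourceAnalyticWitness` (p232342) — W51's pattern VERBATIM for N0j's THIRD END).  ADDITIVE —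
imports S52 module A `Spine/NE1p/DressedRegenerationOnCores` and W51 `Spine/NE1p/DressedSourceAnalyticWitness` (→ S33, W35
`DressedSmallFieldCoresMassWitness` → W33 → W24, pv22's torus) ONLY; THEOREMS ONLY (0 def, 0 `def … : Prop`, 0 cite); every toy datum
is W33∕W35∕W51's BY NAME (`coreFam`, `cM`, `actM`, `ctr0`, `hroom0`, `termsW`, `X₀`, `liveTable`, `Acst`, `hrate_torus`, `hsmall_mu`,
`hH_pencil`, `hM3_pencil`, `coresMuEnd_live`); nothing restated.

WHY THIS FILE.  S52 module A carried N0j's third small-field END — the (w5) REGENERATION CONSTANT along the STRENGTH pencil — to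
(2.14)-cores with (B1a) discharged; like S33 §3 before W51, it had no DECIDED applier.  W35's activity `actM N r hr k s` (W33's live core
family at the letter-budget weight `cM`, source pencil `0 + s • liveTable`) is, read with `h₀ := 0`, `v := liveTable`, a STRENGTH pencil
of any radius `ϱ ≤ 2` (the table ball of W33's class has radius `2`): at `s = 1` the family's live table is ON, at `s = 0` OFF.  So:
* §1 `regenEnd_fires` (kernel; S52 A §1 `regenPart_locE_le_of_coresAt_pencil_mass` EXACTLY ONCE BY NAME, with W51's pencil lemmas
  `hH_pencil` ∕ `hM3_pencil` at radius `ϱ ≤ 2`, NE5's toy letters `(mq, bq, N₀) = (1, 0, 1)` INLINE in the literal binder shapes exactly as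
  W51 §1∕§2 — binders `1 < ϱ ≤ 2`): `‖E[actM 1](X₀) − E[actM 0](X₀)‖ ≤ (e·ν·c₁·K₀²·A·e⁰)∕(ϱ − 1)`, conclusion LITERAL;
  `regenEnd_fires_closed`: `≤ K₀(64,8)∕(ϱ − 1)` (pv22's `torus_consts` ∕ `K₀_four`); `regenEnd_fires_best`: at `ϱ = 2`, `≤ K₀(64,8)`.
* §2 GENUINE — `regen_live`: `E[actM 1](X₀) ≠ E[actM 0](X₀)` (W35 `coresMuEnd_live` at the real strength `t = 1`); `regenEnd_live`:
  the quantity bounded in §1 is NON-ZERO and `≤ K₀(64,8)` — the (B1a)-discharged regeneration END is inhabited by a decided datum on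
  which the regenerated and unregenerated outputs DIFFER (no closed form of the difference is claimed).

HONEST FRAMING.  A decided toy on pv22's periodic carrier; W33∕W35's objects BY NAME; [folklore] kernel steps only; `…∕(ϱ − 1)` is the
(w5) constant's READING c̄ = M·σ∕(ε − σ) along the strength pencil (N0j's author, journal l.21941) — (B1a) discharged at a TOY core, (w5)
NOT discharged on Bałaban's densities; nothing of Bałaban's (2.14) data, densities, minimisers or backgrounds instantiated (0 binders
instantiated on Bałaban's densities); (B1b) ∕ (B3) ∕ (B5) untouched ((B3) = G-ne9p2-5 UNPRINTED, shared with NE9); no wall item; the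
NE1′ wall wording of record v1.8 (T4-DAG v48) — words, not kind — does NOT move; R-t4r2-Q2 NOT met; ABSOLUTE RULE honoured (no
numeral of print; nothing internally minted is cited).  NE1′ ⇐ the named binders — NOT proved, NOT printed; spine PROVED 0∕9; count 9
unchanged.  Rung (B)+1 on ONE finite four-torus — NOT infinite volume, NOT a mass gap, NOT OS on ℝ⁴, NOT Clay.  HONEST DEPENDENCY:
continuum YM on T⁴ ⇐ BetaPertH ∧ nine spine estimates (0/9 proved); BetaPertH ⇐ (D1) ∧ (D4) ∧ CAP+tail; G-an2-4 gates asym, D1 and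
NE2/3/4.
-/

noncomputable section

namespace Summit.QuantumFields.BalabanUV.T4Continuum.NE1p.DressedRegenerationWitness

open scoped BigOperators
open Set Metric MeasureTheory Complex
open Literature.MathematicalPhysics.QuantumFieldTheory.Balaban1983to89
open Literature.MathematicalPhysics.QuantumFieldTheory.Balaban1983to89.B13Resummation (locE)
open Literature.MathematicalPhysics.QuantumFieldTheory.Balaban1983to89.TreeLengthTorus (TDom tsys)
open Literature.MathematicalPhysics.QuantumFieldTheory.Balaban1983to89.TreeLengthTorusGeometry (TTouch tgeometry)
open Literature.MathematicalPhysics.QuantumFieldTheory.Balaban1983to89.B12TreeDecay (K₀ K₀_pos)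
open Summit.QuantumFields.BalabanUV.T4Continuum.B13HistMeasurable (B13HistM)
open Summit.QuantumFields.BalabanUV.T4Continuum.B13HistWitness (toyFrame)
open Summit.QuantumFields.BalabanUV.T4Continuum.NE1p.DressedSmallFieldTorusWitness (X₀ hrate_torus)
open Summit.QuantumFields.BalabanUV.T4Continuum.NE1p.DressedSmallFieldGeometry (torus_consts)
open Summit.QuantumFields.BalabanUV.T4Continuum.NE1p.DressedSmallFieldGeometryFaces (K₀_four)
open Summit.QuantumFields.BalabanUV.T4Continuum.NE1p.DressedSmallFieldCoresWitness (liveTable norm_liveTable_le coreFam ctr0 hroom0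
  Acst Acst_pos termsW)
open Summit.QuantumFields.BalabanUV.T4Continuum.NE1p.DressedSmallFieldCoresMassWitness (cM actM hsmall_mu coresMuEnd_live)
open Summit.QuantumFields.BalabanUV.T4Continuum.NE1p.DressedSourceAnalyticWitness (hH_pencil hM3_pencil)
open Summit.QuantumFields.BalabanUV.T4Continuum.NE1p.DressedRegenerationOnCores (regenPart_locE_le_of_coresAt_pencil_mass)

variable (N : ℕ) [NeZero N] (r : ℝ) (hr : 0 ≤ r)

/-! ## §1 S52's REGENERATION END FIRES on W35's letter-budget activity read along the strength pencil -/

open Classical in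
/-- **S52 A §1 `regenPart_locE_le_of_coresAt_pencil_mass` FIRES ON THE LIVE CORE** [decided toy]: W33's core family at W35's weight
`cM`, NE5's toy letters `(mq, bq, N₀) = (1, 0, 1)` INLINE in the literal binder shapes, W33's `hroom0`∕`ctr0`, the class radii
`‖0 − 0‖ ≤ 1` and `‖0 − 0‖ + ϱ‖liveTable‖ ≤ 2` (W51 `hH_pencil` at `ϱ ≤ 2`), `hscale`∕`hact` by `rfl`, W24's `hrate_torus`, W35's
`hsmall_mu`, W51's `hM3_pencil` (EQUALITY at `X₀`), STRENGTH radius `1 < ϱ ≤ 2`.  Conclusion LITERAL: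
`‖E[actM 1](X₀) − E[actM 0](X₀)‖ ≤ (e·ν·c₁·K₀²·A·e⁰)∕(ϱ − 1)`. [folklore] -/
theorem regenEnd_fires {ϱ : ℝ} (hϱ1 : 1 < ϱ) (hϱ2 : ϱ ≤ 2) (k : ℕ) :
    ‖locE (tgeometry 4 N).ι (tgeometry 4 N).cubes (actM N r hr k 1) ((tgeometry 4 N).cubes (X₀ N)) -
        locE (tgeometry 4 N).ι (tgeometry 4 N).cubes (actM N r hr k 0) ((tgeometry 4 N).cubes (X₀ N))‖ ≤
      Real.exp 1 * (tgeometry 4 N).ν * (tgeometry 4 N).c₁ * (tgeometry 4 N).K₀ ^ 2 * Acst *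
        Real.exp (-(0 * (tsys 4 N).dj (X₀ N))) / (ϱ - 1) :=
  regenPart_locE_le_of_coresAt_pencil_mass (tsys 4 N) (tgeometry 4 N) (coreFam (cM r) r hr)
    (W := Set.univ) (ctr := ctr0) (ROp := fun _ => 1) (RHist := fun _ => 2) (R' := fun _ => 2)
    (mq := fun _ _ _ => 1) (bq := fun _ _ _ => 0) (N₀ := fun _ _ _ => 1)
    hroom0 (fun _ _ _ _ _ _ _ => one_pos)
    (fun _ _ _ _ _ _ _ => ⟨fun _ _ => aestronglyMeasurable_const, fun _ => differentiableOn_const _, fun _ _ _ => by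
      show ‖(1 : ℂ)‖ ≤ 1; rw [norm_one]⟩)
    (fun _ _ _ _ _ _ _ => ⟨fun _ _ => (Complex.measurable_ofReal.comp (measurable_snd.norm.pow_const 2)).aestronglyMeasurable,
      fun _ _ => differentiableOn_const _, fun _ _ _ v => by
        show 1 * ‖v‖ ^ 2 - 0 ≤ (((‖v‖ ^ 2 : ℝ) : ℂ)).re; rw [Complex.ofReal_re]; simp⟩)
    (g := fun _ => 0) (Set.mem_univ _) (U := ()) (o := 0) (h₀ := 0) (v := liveTable) (ϱ := ϱ)
    (by show ‖(0 : ℂ) - 0‖ ≤ 1; simp) (hH_pencil hϱ2 k)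
    (emb := fun _ => k) (fun _ => rfl) (terms := termsW N) (act := actM N r hr k) (fun _ _ _ => rfl)
    (A := Acst) (R := 2 * (tgeometry 4 N).κ₀ + 2) (r₁ := 0) (b₅ := 0) (X₀ := X₀ N)
    Acst_pos.le le_rfl (by norm_num) (hrate_torus N) (hsmall_mu N) (hM3_pencil N r hr hϱ2 k _) hϱ1

open Classical in
/-- … in CLOSED FORM: `‖E[actM 1](X₀) − E[actM 0](X₀)‖ ≤ K₀(64,8)∕(ϱ − 1)` (pv22's constants BY NAME). [folklore] -/
theorem regenEnd_fires_closed {ϱ : ℝ} (hϱ1 : 1 < ϱ) (hϱ2 : ϱ ≤ 2) (k : ℕ) :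
    ‖locE (tgeometry 4 N).ι (tgeometry 4 N).cubes (actM N r hr k 1) ((tgeometry 4 N).cubes (X₀ N)) -
        locE (tgeometry 4 N).ι (tgeometry 4 N).cubes (actM N r hr k 0) ((tgeometry 4 N).cubes (X₀ N))‖ ≤ K₀ 64 8 / (ϱ - 1) := by
  refine (regenEnd_fires N r hr hϱ1 hϱ2 k).trans (le_of_eq ?_)
  rw [(torus_consts N).1, (torus_consts N).2.2, K₀_four, zero_mul, neg_zero, Real.exp_zero, mul_one]
  unfold Acst
  have hK := K₀_pos (64 : ℝ) 8
  have he := Real.exp_pos 1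
  field_simp

open Classical in
/-- … at the BEST strength radius the class allows, `ϱ = 2`: `‖E[actM 1](X₀) − E[actM 0](X₀)‖ ≤ K₀(64,8)`. [folklore] -/
theorem regenEnd_fires_best (k : ℕ) :
    ‖locE (tgeometry 4 N).ι (tgeometry 4 N).cubes (actM N r hr k 1) ((tgeometry 4 N).cubes (X₀ N)) -
        locE (tgeometry 4 N).ι (tgeometry 4 N).cubes (actM N r hr k 0) ((tgeometry 4 N).cubes (X₀ N))‖ ≤ K₀ 64 8 := by
  have h := regenEnd_fires_closed N r hr (ϱ := 2) (by norm_num) le_rfl k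
  norm_num at h
  exact h

/-! ## §2 GENUINE: the regenerated and unregenerated outputs DIFFER — the bound is charged by a live quantity -/

open Classical in
/-- **THE REGENERATED OUTPUT DIFFERS FROM THE UNREGENERATED ONE** [decided toy]: `E[actM 1](X₀) ≠ E[actM 0](X₀)` — W35's
`coresMuEnd_live` BY NAME at the real strength `t = 1` (W24 `exp_locE_cube` inside it). -/
theorem regen_live (hr0 : 0 < r) (k : ℕ) :
    locE (tgeometry 4 N).ι (tgeometry 4 N).cubes (actM N r hr k 1) ((tgeometry 4 N).cubes (X₀ N)) ≠
      locE (tgeometry 4 N).ι (tgeometry 4 N).cubes (actM N r hr k 0) ((tgeometry 4 N).cubes (X₀ N)) := by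
  have h := coresMuEnd_live N r hr hr0 (t := 1) one_pos (by norm_num) k
  rwa [Complex.ofReal_one] at h

open Classical in
/-- **THE REGENERATION END's BOUNDED QUANTITY IS LIVE** [decided toy]: for every strength radius `1 < ϱ ≤ 2` the difference bounded
by `regenEnd_fires_closed` is NON-ZERO — the (B1a)-discharged (w5) END is inhabited by a datum on which it is not vacuous. [folklore] -/
theorem regenEnd_live (hr0 : 0 < r) {ϱ : ℝ} (hϱ1 : 1 < ϱ) (hϱ2 : ϱ ≤ 2) (k : ℕ) :
    locE (tgeometry 4 N).ι (tgeometry 4 N).cubes (actM N r hr k 1) ((tgeometry 4 N).cubes (X₀ N)) -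
        locE (tgeometry 4 N).ι (tgeometry 4 N).cubes (actM N r hr k 0) ((tgeometry 4 N).cubes (X₀ N)) ≠ 0 ∧
      ‖locE (tgeometry 4 N).ι (tgeometry 4 N).cubes (actM N r hr k 1) ((tgeometry 4 N).cubes (X₀ N)) -
          locE (tgeometry 4 N).ι (tgeometry 4 N).cubes (actM N r hr k 0) ((tgeometry 4 N).cubes (X₀ N))‖ ≤ K₀ 64 8 / (ϱ - 1) :=
  ⟨sub_ne_zero.2 (regen_live N r hr hr0 k), regenEnd_fires_closed N r hr hϱ1 hϱ2 k⟩

open Classical in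
/-- Decided instance: on the one-site torus (`N = 1`), at decay rate `r = 1`, strength radius `ϱ = 2`, generation `k = 0`, the
regeneration difference is non-zero and at most `K₀(64,8)`. -/
example : locE (tgeometry 4 1).ι (tgeometry 4 1).cubes (actM 1 1 zero_le_one 0 1) ((tgeometry 4 1).cubes (X₀ 1)) -
      locE (tgeometry 4 1).ι (tgeometry 4 1).cubes (actM 1 1 zero_le_one 0 0) ((tgeometry 4 1).cubes (X₀ 1)) ≠ 0 ∧
    ‖locE (tgeometry 4 1).ι (tgeometry 4 1).cubes (actM 1 1 zero_le_one 0 1) ((tgeometry 4 1).cubes (X₀ 1)) -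
        locE (tgeometry 4 1).ι (tgeometry 4 1).cubes (actM 1 1 zero_le_one 0 0) ((tgeometry 4 1).cubes (X₀ 1))‖ ≤ K₀ 64 8 / (2 - 1) :=
  regenEnd_live 1 1 zero_le_one one_pos (by norm_num) le_rfl 0

end Summit.QuantumFields.BalabanUV.T4Continuum.NE1p.DressedRegenerationWitness

end
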